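import Summits.AtomisticToContinuum.Crystallization.Theorems.HullExactificationCascadeHullGoodEverywhere
import Summits.AtomisticToContinuum.Crystallization.Theorems.HullExactificationCascadeHullExactShellsShells
import HarnessLib

/-!
# Crux `AlphabetGoodHullElement` (stmt-AtomisticToContinuum-15798), line `census-liouville` —
# helpers for stub `stub_censusCleanHullElement`: the wide-window link census along matchings

The census predicate `CC S y` of the line is inlined there; here its pieces are FUNCTION
PARAMETERS pinned by defining equations (no definitions are introduced; the stub instantiates
them with the line's inlined terms by `rfl`): `nnd S y` is the local scale `dist(y, S ∖ {y})` (an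
infimum, `hnnd`), `win S y` the CLOSED window of `y` (points of `S ∖ {y}` within `61/50 · nnd S y`,
`hwin`), `rng S y z` the ring of a window point `z` (window points other than `z` within
`61/50 · nnd S z` OF `z`, `hrng`), and `G S y` the census itself (`hG`: `y` is BUFFERED — every
point of `S` is within `61/50` scales of `y` or at least `13/10` scales away —, has twelve window
points, all ring numbers in `{4, 5}`, and zero or two fives).

Contents: API of the local scale; translation invariance of the census (`cche_clean_translate`,
`cche_particle`); along a one-sided `η`-matching of `δ`-separated sets the local scale moves by
`≤ 2η` (`cche_nnd_le_of_match`), partner maps are injective (`cche_ncard_le_of_mapsTo`), and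
windows / rings map into windows / rings when the target site is buffered (`cche_win_mapsTo`,
`cche_ring_mapsTo`: the threshold `61/50 · d` sits below the particle-free collar
`(61/50 · d, 13/10 · d)`, wider than the matching error when `200 η ≤ δ` — pattern of
`cleR_gappedTwelve_transfer`); and the static half of round 1 of the stub (`cche_static_buf`).
All `[folklore]`; Mathlib + the `hge_*` toolkit; nothing here closes an item.
-/

noncomputable section

namespace Summit.AtomisticToContinuum.Crystallization.Theorems.AlphabetGoodHullElementCensusLiouville

open Summit.AtomisticToContinuum.Crystallization.Theorems.HullExactShells (norm_le_norm_add_dist)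
open Literature.MathematicalPhysics.StatisticalMechanics
open Filter Topology Metric

variable {nnd : Set (EuclideanSpace ℝ (Fin 3)) → EuclideanSpace ℝ (Fin 3) → ℝ}
  {win : Set (EuclideanSpace ℝ (Fin 3)) → EuclideanSpace ℝ (Fin 3) → Set (EuclideanSpace ℝ (Fin 3))}
  {rng : Set (EuclideanSpace ℝ (Fin 3)) → EuclideanSpace ℝ (Fin 3) → EuclideanSpace ℝ (Fin 3) →
    Set (EuclideanSpace ℝ (Fin 3))}
  {G : Set (EuclideanSpace ℝ (Fin 3)) → EuclideanSpace ℝ (Fin 3) → Prop}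
  (hnnd : ∀ S y, nnd S y = sInf ((fun z => dist z y) '' (S \ {y})))
  (hwin : ∀ S y, win S y =
    {z : EuclideanSpace ℝ (Fin 3) | z ∈ S ∧ z ≠ y ∧ dist z y ≤ 61 / 50 * nnd S y})
  (hrng : ∀ S y z, rng S y z =
    {w : EuclideanSpace ℝ (Fin 3) | w ∈ win S y ∧ w ≠ z ∧ dist w z ≤ 61 / 50 * nnd S z})
  (hG : ∀ S y, G S y ↔
    (∀ z ∈ S, dist z y ≤ 61 / 50 * nnd S y ∨ 13 / 10 * nnd S y ≤ dist z y) ∧ (win S y).ncard = 12 ∧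
      (∀ z ∈ win S y, (rng S y z).ncard = 4 ∨ (rng S y z).ncard = 5) ∧
      ({z : EuclideanSpace ℝ (Fin 3) | z ∈ win S y ∧ (rng S y z).ncard = 5}.ncard = 0 ∨
        {z : EuclideanSpace ℝ (Fin 3) | z ∈ win S y ∧ (rng S y z).ncard = 5}.ncard = 2))
  {S : Set (EuclideanSpace ℝ (Fin 3))} {y z : EuclideanSpace ℝ (Fin 3)} {δ : ℝ}

/-! ## The local scale, windows, rings -/

include hnnd in
/-- The local scale is at most the distance to any other point. [folklore] -/
theorem cche_nnd_le (hz : z ∈ S) (hzy : z ≠ y) : nnd S y ≤ dist z y := by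
  rw [hnnd]
  exact hge_sInf_le_dist hz hzy

include hnnd in
/-- The local scale is non-negative. [folklore] -/
theorem cche_nnd_nonneg (S : Set (EuclideanSpace ℝ (Fin 3))) (y : EuclideanSpace ℝ (Fin 3)) :
    0 ≤ nnd S y := by
  rw [hnnd]
  exact Real.sInf_nonneg (by rintro _ ⟨z, -, rfl⟩; exact dist_nonneg)

include hnnd in
/-- In a `δ`-separated set with another point, the local scale is `≥ δ`. [folklore] -/
theorem cche_delta_le_nnd (hsep : ∀ p ∈ S, ∀ q ∈ S, p ≠ q → δ ≤ dist p q) (hy : y ∈ S)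
    (hne : (S \ {y}).Nonempty) : δ ≤ nnd S y := by
  rw [hnnd]
  exact hge_le_sInf_dists hne fun z hz hzy => by rw [dist_comm]; exact hsep y hy z hz hzy.symm

include hnnd in
/-- Points almost realising the local scale. [folklore] -/
theorem cche_exists_lt (hne : (S \ {y}).Nonempty) {θ : ℝ} (hθ : 0 < θ) :
    ∃ z ∈ S, z ≠ y ∧ dist z y < nnd S y + θ := by
  rw [hnnd]
  obtain ⟨_, ⟨z, ⟨hz, hzy⟩, rfl⟩, hlt⟩ := exists_lt_of_csInf_lt (hne.image (fun z => dist z y))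
    (lt_add_of_pos_right (sInf ((fun z => dist z y) '' (S \ {y}))) hθ)
  exact ⟨z, hz, hzy, hlt⟩

include hwin in
/-- Membership in the window, unfolded. [folklore] -/
theorem cche_mem_win : z ∈ win S y ↔ z ∈ S ∧ z ≠ y ∧ dist z y ≤ 61 / 50 * nnd S y := by
  rw [hwin, Set.mem_setOf_eq]

include hrng in
/-- Membership in a ring, unfolded. [folklore] -/
theorem cche_mem_rng {w : EuclideanSpace ℝ (Fin 3)} :
    w ∈ rng S y z ↔ w ∈ win S y ∧ w ≠ z ∧ dist w z ≤ 61 / 50 * nnd S z := by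
  rw [hrng, Set.mem_setOf_eq]

include hwin in
/-- Windows of separated sets are finite. [folklore] -/
theorem cche_win_finite (hδ : 0 < δ) (hsep : ∀ p ∈ S, ∀ q ∈ S, p ≠ q → δ ≤ dist p q) :
    (win S y).Finite := by
  rw [hwin]
  exact finite_of_forall_le_dist_of_subset_closedBall hδ
    (fun p hp q hq hpq => hsep p hp.1 q hq.1 hpq) (c := y) (R := 61 / 50 * nnd S y)
    fun _ hw => mem_closedBall.2 hw.2.2

include hwin in
/-- A site with twelve window points has another point. [folklore] -/
theorem cche_nonempty_of_win (h : (win S y).ncard = 12) : (S \ {y}).Nonempty := by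
  obtain ⟨z, hz⟩ := Set.nonempty_of_ncard_ne_zero (s := win S y) (by rw [h]; norm_num)
  rw [hwin] at hz
  exact ⟨z, hz.1, hz.2.1⟩

/-! ## Translation invariance -/

include hnnd in
/-- The local scale is translation invariant. [folklore] -/
theorem cche_nnd_translate (S : Set (EuclideanSpace ℝ (Fin 3))) (y c : EuclideanSpace ℝ (Fin 3)) :
    nnd ((fun z => z + c) '' S) (y + c) = nnd S y := by
  rw [hnnd, hnnd]
  congr 1
  ext r
  simp only [Set.mem_image, Set.mem_sdiff, Set.mem_singleton_iff]
  constructor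
  · rintro ⟨_, ⟨⟨z, hz, rfl⟩, hzy⟩, rfl⟩
    exact ⟨z, ⟨hz, fun h => hzy (by rw [h])⟩, by rw [dist_add_right]⟩
  · rintro ⟨z, ⟨hz, hzy⟩, rfl⟩
    exact ⟨z + c, ⟨⟨z, hz, rfl⟩, fun h => hzy (add_right_cancel h)⟩, by rw [dist_add_right]⟩

include hnnd hwin in
/-- The window is translation covariant. [folklore] -/
theorem cche_win_translate (S : Set (EuclideanSpace ℝ (Fin 3))) (y c : EuclideanSpace ℝ (Fin 3)) :
    win ((fun z => z + c) '' S) (y + c) = (fun z => z + c) '' win S y := by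
  ext w
  rw [hwin, hwin]
  simp only [Set.mem_setOf_eq, Set.mem_image, cche_nnd_translate hnnd]
  constructor
  · rintro ⟨⟨z, hz, rfl⟩, hzy, hd⟩
    rw [dist_add_right] at hd
    exact ⟨z, ⟨hz, fun h => hzy (by rw [h]), hd⟩, rfl⟩
  · rintro ⟨z, ⟨hz, hzy, hd⟩, rfl⟩
    exact ⟨⟨z, hz, rfl⟩, fun h => hzy (add_right_cancel h), by rwa [dist_add_right]⟩

include hnnd hwin hrng in
/-- Rings are translation covariant. [folklore] -/
theorem cche_rng_translate (S : Set (EuclideanSpace ℝ (Fin 3))) (y z c : EuclideanSpace ℝ (Fin 3)) :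
    rng ((fun z => z + c) '' S) (y + c) (z + c) = (fun z => z + c) '' rng S y z := by
  ext w
  rw [hrng, hrng]
  simp only [Set.mem_setOf_eq, cche_win_translate hnnd hwin, cche_nnd_translate hnnd,
    Set.mem_image]
  constructor
  · rintro ⟨⟨v, hv, rfl⟩, hvz, hd⟩
    rw [dist_add_right] at hd
    exact ⟨v, ⟨hv, fun h => hvz (by rw [h]), hd⟩, rfl⟩
  · rintro ⟨v, ⟨hv, hvz, hd⟩, rfl⟩
    exact ⟨⟨v, hv, rfl⟩, fun h => hvz (add_right_cancel h), by rwa [dist_add_right]⟩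

include hnnd hwin hrng in
/-- Five-sets are translation covariant. [folklore] -/
theorem cche_five_translate (S : Set (EuclideanSpace ℝ (Fin 3))) (y c : EuclideanSpace ℝ (Fin 3)) :
    {z' : EuclideanSpace ℝ (Fin 3) | z' ∈ win ((fun z => z + c) '' S) (y + c) ∧
        (rng ((fun z => z + c) '' S) (y + c) z').ncard = 5} =
      (fun z => z + c) '' {z : EuclideanSpace ℝ (Fin 3) | z ∈ win S y ∧ (rng S y z).ncard = 5} := by
  ext w
  simp only [Set.mem_setOf_eq, cche_win_translate hnnd hwin, Set.mem_image]
  constructor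
  · rintro ⟨⟨v, hv, rfl⟩, h5⟩
    rw [cche_rng_translate hnnd hwin hrng,
      Set.ncard_image_of_injective _ (add_left_injective c)] at h5
    exact ⟨v, ⟨hv, h5⟩, rfl⟩
  · rintro ⟨v, ⟨hv, h5⟩, rfl⟩
    refine ⟨⟨v, hv, rfl⟩, ?_⟩
    rw [cche_rng_translate hnnd hwin hrng, Set.ncard_image_of_injective _ (add_left_injective c)]
    exact h5

include hnnd hwin hrng hG in
/-- The census is translation invariant. [folklore] -/
theorem cche_clean_translate (h : G S y) (c : EuclideanSpace ℝ (Fin 3)) :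
    G ((fun z => z + c) '' S) (y + c) := by
  obtain ⟨hB, hW, hR, hF⟩ := (hG _ _).1 h
  refine (hG _ _).2 ⟨?_, ?_, ?_, ?_⟩
  · rintro _ ⟨z, hz, rfl⟩
    rw [cche_nnd_translate hnnd, dist_add_right]
    exact hB z hz
  · rw [cche_win_translate hnnd hwin, Set.ncard_image_of_injective _ (add_left_injective c)]
    exact hW
  · rw [cche_win_translate hnnd hwin]
    rintro _ ⟨z, hz, rfl⟩
    rw [cche_rng_translate hnnd hwin hrng, Set.ncard_image_of_injective _ (add_left_injective c)]
    exact hR z hz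
  · rw [cche_five_translate hnnd hwin hrng, Set.ncard_image_of_injective _ (add_left_injective c)]
    exact hF

include hnnd hwin hrng hG in
/-- **Per-particle census.** A census-clean particle of an injective, `R₀`-bonded finite
configuration is census-clean in the translated configuration, with local scale `≤ R₀`.
[folklore] -/
theorem cche_particle {N : ℕ} {x : Fin N → EuclideanSpace ℝ (Fin 3)} {R₀ : ℝ}
    (hinj : Function.Injective x)
    (hbond : ∀ i j : Fin N, j ≠ i → ∃ k : Fin N, k ≠ i ∧ dist (x i) (x k) ≤ R₀) {j : Fin N}
    (hg : G (Set.range x) (x j)) (c : EuclideanSpace ℝ (Fin 3)) :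
    G (Set.range fun i => x i + c) (x j + c) ∧ nnd (Set.range fun i => x i + c) (x j + c) ≤ R₀ := by
  rw [hge_range_add_const, cche_nnd_translate hnnd]
  refine ⟨cche_clean_translate hnnd hwin hrng hG hg c, ?_⟩
  obtain ⟨z, hz, hzy⟩ := cche_nonempty_of_win hwin ((hG _ _).1 hg).2.1
  obtain ⟨j', rfl⟩ := hz
  obtain ⟨k, hkj, hk⟩ := hbond j j' fun h => hzy (Set.mem_singleton_iff.2 (by rw [h]))
  calc nnd (Set.range x) (x j) ≤ dist (x k) (x j) :=
        cche_nnd_le hnnd (Set.mem_range_self k) fun h => hkj (hinj h)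
    _ ≤ R₀ := by rwa [dist_comm]

/-! ## Matchings: the local scale, and injections of windows and rings -/

include hnnd in
/-- **The local scale along a one-sided matching.** If every point of `X` of norm `≤ R` has a
partner in `X'` within `η` (`2η < δ`, `X` `δ`-separated), `p ∈ X` has another point in `X`, and
`dist p p' ≤ η`, then `p'` has another point in `X'` and `nnd X' p' ≤ nnd X p + 2η` (for
`R ≥ ‖p‖ + nnd X p + 1`). [folklore] -/
theorem cche_nnd_le_of_match {X X' : Set (EuclideanSpace ℝ (Fin 3))} {δ η R : ℝ}
    {p p' : EuclideanSpace ℝ (Fin 3)}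
    (hsep : ∀ a ∈ X, ∀ b ∈ X, a ≠ b → δ ≤ dist a b) (h2η : 2 * η < δ)
    (hM : ∀ s ∈ X, ‖s‖ ≤ R → ∃ a ∈ X', dist a s ≤ η)
    (hp : p ∈ X) (hpp' : dist p p' ≤ η) (hne : (X \ {p}).Nonempty)
    (hR : ‖p‖ + nnd X p + 1 ≤ R) :
    (X' \ {p'}).Nonempty ∧ nnd X' p' ≤ nnd X p + 2 * η := by
  have key : ∀ θ : ℝ, 0 < θ → θ ≤ 1 →
      ∃ a ∈ X', a ≠ p' ∧ dist a p' < nnd X p + 2 * η + θ := by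
    intro θ hθ hθ1
    obtain ⟨s, hs, hsp, hlt⟩ := cche_exists_lt hnnd hne hθ
    have hsR : ‖s‖ ≤ R := by linarith [norm_le_norm_add_dist s p]
    obtain ⟨a, ha, has⟩ := hM s hs hsR
    have hδsp : δ ≤ dist s p := hsep s hs p hp hsp
    refine ⟨a, ha, fun hap => ?_, ?_⟩
    · rw [hap] at has
      have := dist_triangle s p' p
      rw [dist_comm s p', dist_comm p' p] at this
      linarith
    · calc dist a p' ≤ dist a s + dist s p + dist p p' := dist_triangle4 a s p p'
        _ < _ := by linarith
  constructor
  · obtain ⟨a, ha, hap, -⟩ := key 1 one_pos le_rfl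
    exact ⟨a, ha, fun h => hap (Set.mem_singleton_iff.1 h)⟩
  · refine le_of_forall_pos_le_add fun θ hθ => ?_
    obtain ⟨a, ha, hap, hlt⟩ := key (min θ 1) (by positivity) (min_le_right _ _)
    calc nnd X' p' ≤ dist a p' := cche_nnd_le hnnd ha hap
      _ ≤ nnd X p + 2 * η + θ := by linarith [min_le_left θ 1]

/-- **Counting along a matching.** If every point of the `δ`-separated `A` has a partner in the
finite `B` within `η`, `2η < δ`, then `A.ncard ≤ B.ncard` (the partner map is injective).
[folklore] -/
theorem cche_ncard_le_of_mapsTo {A B : Set (EuclideanSpace ℝ (Fin 3))} {δ η : ℝ}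
    (hsepA : ∀ a ∈ A, ∀ b ∈ A, a ≠ b → δ ≤ dist a b) (h2η : 2 * η < δ) (hBfin : B.Finite)
    (hmaps : ∀ w ∈ A, ∃ w' ∈ B, dist w' w ≤ η) : A.ncard ≤ B.ncard := by
  classical
  choose! f hf using hmaps
  refine Set.ncard_le_ncard_of_injOn f (fun w hw => (hf w hw).1) ?_ hBfin
  intro w₁ h₁ w₂ h₂ heq
  by_contra hne
  have hsep := hsepA w₁ h₁ w₂ h₂ hne
  have : dist w₁ w₂ ≤ 2 * η :=
    calc dist w₁ w₂ ≤ dist (f w₁) w₁ + dist (f w₁) w₂ := dist_triangle_left _ _ _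
      _ ≤ η + η := add_le_add (hf w₁ h₁).2 (by rw [heq]; exact (hf w₂ h₂).2)
      _ = 2 * η := by ring
  linarith

include hnnd hwin in
/-- **Windows map into windows.** Along a one-sided `η`-matching of `X` into `X'` (`200η ≤ δ`),
if the local scales at `p ∈ X` and at `p'` (`dist p p' ≤ η`) differ by `≤ 2η`, the scale at `p'`
is `≥ δ` and `p'` is buffered in `X'`, then every window point of `p` has a partner in the
window of `p'`: its partner lands below `13/10` scales, hence (buffer) in the closed window.
[folklore] -/
theorem cche_win_mapsTo {X X' : Set (EuclideanSpace ℝ (Fin 3))} {δ η R : ℝ}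
    {p p' : EuclideanSpace ℝ (Fin 3)} (hδ : 0 < δ)
    (hsep : ∀ a ∈ X, ∀ b ∈ X, a ≠ b → δ ≤ dist a b) (hηδ : 200 * η ≤ δ)
    (hM : ∀ s ∈ X, ‖s‖ ≤ R → ∃ a ∈ X', dist a s ≤ η)
    (hp : p ∈ X) (hpp' : dist p p' ≤ η) (hR : ‖p‖ + 4 * nnd X p + 4 ≤ R)
    (hdd' : nnd X p ≤ nnd X' p' + 2 * η) (hδd' : δ ≤ nnd X' p')
    (hB' : ∀ z ∈ X', dist z p' ≤ 61 / 50 * nnd X' p' ∨ 13 / 10 * nnd X' p' ≤ dist z p') :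
    ∀ w ∈ win X p, ∃ w' ∈ win X' p', dist w' w ≤ η := by
  intro w hw
  obtain ⟨hwX, hwp, hwd⟩ := (cche_mem_win hwin).1 hw
  have hwR : ‖w‖ ≤ R := by linarith [norm_le_norm_add_dist w p, cche_nnd_nonneg hnnd X p]
  obtain ⟨w', hw', hw'w⟩ := hM w hwX hwR
  have hδwp : δ ≤ dist w p := hsep w hwX p hp hwp
  have hne : w' ≠ p' := by
    intro h
    rw [h] at hw'w
    have := dist_triangle w p' p
    rw [dist_comm w p', dist_comm p' p] at this
    linarith
  have hup : dist w' p' ≤ 61 / 50 * nnd X p + 2 * η :=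
    calc dist w' p' ≤ dist w' w + dist w p + dist p p' := dist_triangle4 _ _ _ _
      _ ≤ _ := by linarith
  refine ⟨w', (cche_mem_win hwin).2 ⟨hw', hne, ?_⟩, hw'w⟩
  rcases hB' w' hw' with h | h
  · exact h
  · exfalso
    linarith

include hwin hrng in
/-- **Rings map into rings.** If windows map into windows (partners within `η`, `200η ≤ δ`),
`z` is a window point of `p` in `X`, `dist z' z ≤ η`, the local scales at `z`, `z'` differ by
`≤ 2η`, the scale at `z'` is `≥ δ`, and `z'` is buffered in `X'`, then every ring point of `z`
has a partner in the ring of `z'`. [folklore] -/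
theorem cche_ring_mapsTo {X X' : Set (EuclideanSpace ℝ (Fin 3))} {δ η : ℝ}
    {p p' z z' : EuclideanSpace ℝ (Fin 3)} (hδ : 0 < δ)
    (hsep : ∀ a ∈ X, ∀ b ∈ X, a ≠ b → δ ≤ dist a b) (hηδ : 200 * η ≤ δ)
    (hmaps : ∀ w ∈ win X p, ∃ w' ∈ win X' p', dist w' w ≤ η)
    (hz : z ∈ win X p) (hzz' : dist z' z ≤ η)
    (hee' : nnd X z ≤ nnd X' z' + 2 * η) (hδe' : δ ≤ nnd X' z')
    (hBz' : ∀ w ∈ X', dist w z' ≤ 61 / 50 * nnd X' z' ∨ 13 / 10 * nnd X' z' ≤ dist w z') :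
    ∀ w ∈ rng X p z, ∃ w' ∈ rng X' p' z', dist w' w ≤ η := by
  intro w hw
  obtain ⟨hwW, hwz, hwd⟩ := (cche_mem_rng hrng).1 hw
  obtain ⟨w', hw'W, hw'w⟩ := hmaps w hwW
  have hδwz : δ ≤ dist w z :=
    hsep w ((cche_mem_win hwin).1 hwW).1 z ((cche_mem_win hwin).1 hz).1 hwz
  have hne : w' ≠ z' := by
    intro h
    rw [h] at hw'w
    have := dist_triangle w z' z
    rw [dist_comm w z'] at this
    linarith
  have hup : dist w' z' ≤ 61 / 50 * nnd X z + 2 * η :=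
    calc dist w' z' ≤ dist w' w + dist w z + dist z z' := dist_triangle4 _ _ _ _
      _ ≤ _ := by rw [dist_comm z z']; linarith
  refine ⟨w', (cche_mem_rng hrng).2 ⟨hw'W, hne, ?_⟩, hw'w⟩
  rcases hBz' w' ((cche_mem_win hwin).1 hw'W).1 with h | h
  · exact h
  · exfalso
    linarith

/-! ## Round 1, static part: the buffer alternative along one matching -/

include hnnd in
/-- **Static round 1.** Let `X` (an approximant) and `X'` (the limit) be `δ`-separated and two-way
`η`-matched on a large ball (`2η < δ`), `p ∈ X` buffered and not isolated with scale `≤ R₀`,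
`p' ∈ X'`, `dist p p' ≤ η`.  Then `p'` is not isolated, its scale is `≤ R₀ + 2η`, and every other
point of `X'` within `13/10·R₀` of `p'` is within `61/50` scales `+ 5η` or beyond `13/10` scales
`- 5η` of `p'`. [folklore] -/
theorem cche_static_buf {X X' : Set (EuclideanSpace ℝ (Fin 3))} {δ η R R₀ : ℝ}
    {p p' : EuclideanSpace ℝ (Fin 3)}
    (hsep : ∀ a ∈ X, ∀ b ∈ X, a ≠ b → δ ≤ dist a b)
    (hsep' : ∀ a ∈ X', ∀ b ∈ X', a ≠ b → δ ≤ dist a b)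
    (hη : 0 < η) (h2η : 2 * η < δ) (hM : BallMatch η R 0 X X')
    (hp : p ∈ X) (hp' : p' ∈ X') (hpp' : dist p p' ≤ η)
    (hB : ∀ z ∈ X, dist z p ≤ 61 / 50 * nnd X p ∨ 13 / 10 * nnd X p ≤ dist z p)
    (hne : (X \ {p}).Nonempty) (hd : nnd X p ≤ R₀) (hR : ‖p'‖ + 3 * R₀ + 3 ≤ R) :
    (X' \ {p'}).Nonempty ∧ nnd X' p' ≤ R₀ + 2 * η ∧
      ∀ z ∈ X', z ≠ p' → dist z p' < 13 / 10 * R₀ →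
        (dist z p' ≤ 61 / 50 * nnd X' p' + 5 * η ∨ 13 / 10 * nnd X' p' - 5 * η ≤ dist z p') := by
  have hM1 : ∀ s ∈ X', ‖s‖ ≤ R → ∃ a ∈ X, dist a s ≤ η := fun s hs hsR =>
    hM.1 s hs (by rwa [dist_zero_right])
  have hM2 : ∀ s ∈ X, ‖s‖ ≤ R → ∃ a ∈ X', dist a s ≤ η := fun s hs hsR => by
    obtain ⟨a, ha, has⟩ := hM.2 s hs (by rwa [dist_zero_right])
    exact ⟨a, ha, by rwa [dist_comm]⟩
  have hδd : δ ≤ nnd X p := cche_delta_le_nnd hnnd hsep hp hne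
  have hpn : ‖p‖ ≤ ‖p'‖ + η := by linarith [norm_le_norm_add_dist p p']
  have hp'p : dist p' p ≤ η := by rwa [dist_comm]
  have hR1 : ‖p‖ + nnd X p + 1 ≤ R := by linarith
  obtain ⟨hne', hdd'⟩ := cche_nnd_le_of_match hnnd hsep h2η hM2 hp hpp' hne hR1
  have hR2 : ‖p'‖ + nnd X' p' + 1 ≤ R := by linarith
  obtain ⟨-, hd'd⟩ := cche_nnd_le_of_match hnnd hsep' h2η hM1 hp' hp'p hne' hR2
  refine ⟨hne', by linarith, fun z hz hzp hzlt => ?_⟩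
  have hzR : ‖z‖ ≤ R := by linarith [norm_le_norm_add_dist z p']
  obtain ⟨a, ha, haz⟩ := hM1 z hz hzR
  have hδz : δ ≤ dist z p' := hsep' z hz p' hp' hzp
  have hap : a ≠ p := by
    intro h
    rw [h] at haz
    have := dist_triangle z p p'
    rw [dist_comm z p] at this
    linarith
  have h1 : dist a p ≤ dist z p' + 2 * η :=
    calc dist a p ≤ dist a z + dist z p' + dist p' p := dist_triangle4 _ _ _ _
      _ ≤ _ := by rw [dist_comm p' p]; linarith
  have h2 : dist z p' ≤ dist a p + 2 * η :=
    calc dist z p' ≤ dist z a + dist a p + dist p p' := dist_triangle4 _ _ _ _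
      _ ≤ _ := by rw [dist_comm z a]; linarith
  rcases hB a ha with h | h
  · left
    linarith
  · right
    linarith

end Summit.AtomisticToContinuum.Crystallization.Theorems.AlphabetGoodHullElementCensusLiouville

end
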